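import Summits.ResolutionOfSingularities.ResolutionOfSingularities.Theses.IndSmooth
import Summits.ResolutionOfSingularities.ResolutionOfSingularities.Theorems.IndSmoothValuativeSmoothingExistsMinimal
import Summits.ResolutionOfSingularities.ResolutionOfSingularities.Theorems.IndSmoothValuativeSmoothingRefineOfNotZeroDim
import Summits.ResolutionOfSingularities.ResolutionOfSingularities.Theorems.IndSmoothValuativeSmoothingDiscreteJumps
import Summits.ResolutionOfSingularities.ResolutionOfSingularities.Theorems.IndSmoothValuativeSmoothingOfRelLU
import Summits.ResolutionOfSingularities.ResolutionOfSingularities.Theorems.IndSmoothValuativeSmoothingRelLURegularCentre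
import Summits.ResolutionOfSingularities.ResolutionOfSingularities.Theorems.IndSmoothValuativeSmoothingDiscreteChainOfNoetherian
import Literature.AlgebraicGeometry.Resolution.LocalUniformizationAbhyankarPlaces
import HarnessLib

/-!
# The crux `ValuativeSmoothing` is equivalent, unconditionally, to itself on its open core

Support file for crux stmt-ResolutionOfSingularities-16087 (`IndSmooth.ValuativeSmoothing`, route
`ResolutionOfSingularities/IndSmooth`), line `birth`, lead seat c3 — the END STATE of reshape r8,
stated against the route decl. Eight families of valuation rings `O ⊇ k` of a finitely generated
`K/k` (`k` perfect of characteristic `p`) satisfy the crux by LANDED theorems: Noetherian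
(p156666), Abhyankar places (p153647), all jumps discrete (p164049), a regular centre of dimension
`≤ 2` on some affine model (p169096), every `O` admitting relative local uniformization (p169280),
composites over a uniformizable coarsening with finitely generated residue field and a residue
valuation of the previous types (p170234, p170915), and composites over a uniformizable coarsening
with residue field of transcendence degree `≤ 1`, finitely generated or not (this cycle,
`smoothFactor_of_le_of_relLU_of_residueTrdegLeOne`). This file proves:

* `valuativeSmoothing_iff_core` — UNCONDITIONALLY, `ValuativeSmoothing` is equivalent to its
  restriction to the OPEN CORE: zero-dimensional `O` (residue field algebraic over `k`) that are
  not Noetherian, not Abhyankar, admit no discrete chain of coarsenings, no affine model with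
  regular centre of dimension `≤ 2`, and no relative local uniformization over `k` (the six side
  conditions of the registered stub `stub_coreCrux` of the skeleton `Cruxes/ValuativeSmoothing/
  Lines/birth.lean`, r8). `←`: zero-dimensional refinement (p150237 + p151171), then the case
  split of the r8 composition. `→`: trivial.
* `valuativeSmoothing_iff_minimalCore` — the same with only THREE side conditions
  (zero-dimensional ∧ no discrete chain ∧ no relative LU): `¬ Noetherian` follows from "no
  discrete chain" (`stub_discreteChainOfNoetherian`, p173229), `¬ Abhyankar` and "no regular
  `≤ 2`-centre" from `¬ RelLU` (Knaf–Kuhlmann `relLU_at_abhyankarPlace_of_perfectField`;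
  `relLU_of_regularCentre`, p169817).
* (companion file `IndSmoothValuativeSmoothingCoreKernelEquivalence.lean`) MODULO Temkin's
  relative inseparable local uniformization, `ValuativeSmoothing` ⟺ one `p`-th root smoothing on
  the core (the registered kernel `stub_pthRootSmoothing` of r2–r7).

So the OPEN CONTENT of the crux is exactly `stub_coreCrux`, in either form (census of why it is
of local-uniformization strength: `Cruxes/ValuativeSmoothing/KERNEL-c3.md`).

## Sources

M. Temkin, *Inseparable local uniformization*, J. Algebra 373 (2013), Thm. 1.3.2, Rem. 1.3.5 (iii)
[Temkin2013]; B. Antieau, R. Datta, Math. Z. 299 (2021), Prop. 27 [AntieauDatta2021];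
J. Novacoski, M. Spivakovsky, arXiv:1204.4751, §2.1 [NovacoskiSpivakovsky2014]; H. Knaf,
F.-V. Kuhlmann, Ann. Sci. ÉNS 38 (2005), Thm. 1.1 [KnafKuhlmann2005].
-/

-- single-problem summit: the doubled namespace component is forced
set_option linter.dupNamespace false

open scoped Polynomial
open IsLocalRing Literature.AlgebraicGeometry.Resolution
open Summit.ResolutionOfSingularities.ResolutionOfSingularities.Theses.IndSmooth (ValuativeSmoothing)

namespace Summit.ResolutionOfSingularities.ResolutionOfSingularities.Theorems.ValuativeSmoothing

/-! ## Redundancy of three of the six side conditions -/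

/-- **Relative local uniformization at an Abhyankar place over a perfect field**, in the shape
`RelLocalUniformization k K O` (Knaf–Kuhlmann 2005, Thm. 1.1 with Cor. 2.2; the tree's
`relLU_at_abhyankarPlace_of_perfectField` dominates any finitely generated `R ⊆ O`).
[cite: KnafKuhlmann2005, Thm. 1.1 and Cor. 2.2] -/
theorem relLU_of_isAbhyankarPlace_of_perfectField {k K : Type} [Field k] [PerfectField k]
    [Field K] [Algebra k K] (hK : (⊤ : IntermediateField k K).FG) (O : ValuationSubring K)
    (hO : ∀ c : k, algebraMap k K c ∈ O) (hAbh : IsAbhyankarPlace O (algebraMap k K).fieldRange ⊤) :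
    RelLocalUniformization k K O := by
  intro R hR _ hRO
  obtain ⟨A, h, hRA, hAfg, -, hreg⟩ := relLU_at_abhyankarPlace_of_perfectField hK O hO hAbh R hR hRO
  exact ⟨A, h, hRA, hAfg, hreg⟩

/-- **A regular centre of dimension `≤ 2` on some affine model gives relative local
uniformization** (restated from `relLU_of_regularCentre`, p169817, in the negated-existential
shape of the core's `hnR2`). [cite: Abhyankar1956Valuations, Lemma 12] -/
theorem relLU_of_exists_regularCentre {k K : Type} [Field k] [Field K] [Algebra k K]
    (O : ValuationSubring K)
    (h : ∃ B : Subalgebra k K, B.FG ∧ B.toSubring ≤ O.toSubring ∧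
      (∀ z : K, ∃ a ∈ B, ∃ b ∈ B, b ≠ 0 ∧ z = a / b) ∧
      IsRegularLocalRing (locAtCentre B.toSubring O) ∧
      ringKrullDim (locAtCentre B.toSubring O) ≤ 2) :
    RelLocalUniformization k K O := by
  obtain ⟨B, hBfg, hBO, hfrac, hreg, hdim⟩ := h
  exact relLU_of_regularCentre k K O B hBfg hBO hfrac hreg hdim

/-! ## The crux from its core (the r8 composition against the route decl) -/

/-- **`ValuativeSmoothing` from the crux on its open core** (six side conditions, as registered
in `stub_coreCrux`): reduce to a zero-dimensional `O' ≤ O` containing `R` (a minimal valuation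
subring over `R`, p150237, is zero-dimensional, p151171); if `O'` has a discrete chain of
coarsenings, the discrete-jumps family (p164049) concludes; if `O'` admits relative local
uniformization, the transfer (p169280) concludes; otherwise `O'` is in the core — not Noetherian
by `stub_discreteChainOfNoetherian` (p173229), not Abhyankar and without regular `≤ 2`-centre by
the two lemmas above — and the hypothesis applies. [folklore] -/
theorem valuativeSmoothing_of_core
    (hC : ∀ p : ℕ, p.Prime →
      ∀ (k K : Type) [Field k] [CharP k p] [PerfectField k] [Field K] [Algebra k K],
        (⊤ : IntermediateField k K).FG → ∀ O : ValuationSubring K,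
          (∀ c : k, algebraMap k K c ∈ O) →
          (∀ x ∈ O, ∃ f : k[X], f ≠ 0 ∧ Polynomial.aeval x f ∈ O.nonunits) →
          ¬ IsNoetherianRing O →
          ¬ IsAbhyankarPlace O (algebraMap k K).fieldRange ⊤ →
          (¬ ∃ (N : ℕ) (Os : Fin (N + 1) → ValuationSubring K) (e : Fin N → K)
            (he : ∀ i : Fin N, e i ∈ Os i.castSucc), (∀ i : Fin N, e i ≠ 0) ∧
            (∀ i : Fin N, IsLocalRing.maximalIdeal (Os i.castSucc) =
              Ideal.span {(⟨e i, he i⟩ : Os i.castSucc)}) ∧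
            (∀ (i : Fin N) (x : K), x ∈ Os i.succ ↔ ∃ n : ℕ, e i ^ n * x ∈ Os i.castSucc) ∧
            Os (Fin.last N) = ⊤ ∧ Os 0 = O) →
          (¬ ∃ B : Subalgebra k K, B.FG ∧ B.toSubring ≤ O.toSubring ∧
            (∀ z : K, ∃ a ∈ B, ∃ b ∈ B, b ≠ 0 ∧ z = a / b) ∧
            IsRegularLocalRing (locAtCentre B.toSubring O) ∧
            ringKrullDim (locAtCentre B.toSubring O) ≤ 2) →
          ¬ RelLocalUniformization k K O →
          ∀ R : Subalgebra k K, R.FG → R.toSubring ≤ O.toSubring →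
            ∃ (T : Type) (_ : CommRing T) (_ : Algebra k T), Algebra.Smooth k T ∧
              ∃ (ψ : R →ₐ[k] T) (χ : T →ₐ[k] K), (∀ t : T, χ t ∈ O) ∧ ∀ r : R, χ (ψ r) = (r : K)) :
    ValuativeSmoothing := by
  intro p hp k K _ _ _ _ _ hK O hO R hR hRO
  -- zero-dimensional refinement `R ⊆ O' ≤ O`
  obtain ⟨O', hRO', hO'O, hmin⟩ := stub_existsMinimal k K O R hRO
  have hZ : ∀ x ∈ O', ∃ f : k[X], f ≠ 0 ∧ Polynomial.aeval x f ∈ O'.nonunits := by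
    by_contra hZ
    obtain ⟨O'', hRO'', hle, hne⟩ := stub_refineOfNotZeroDim k K O' R hR hRO' hZ
    exact hne (hmin O'' hRO'' hle)
  have hO' : ∀ c : k, algebraMap k K c ∈ O' := fun c => hRO' (R.algebraMap_mem c)
  suffices h : ∃ (T : Type) (_ : CommRing T) (_ : Algebra k T), Algebra.Smooth k T ∧
      ∃ (ψ : R →ₐ[k] T) (χ : T →ₐ[k] K), (∀ t : T, χ t ∈ O') ∧ ∀ r : R, χ (ψ r) = (r : K) by
    obtain ⟨T, instT, instTA, hT, ψ, χ, hχ, hc⟩ := h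
    exact ⟨T, instT, instTA, hT, ψ, χ, fun t => hO'O (hχ t), hc⟩
  -- families 1 and 3: a discrete chain of coarsenings
  by_cases hD : ∃ (N : ℕ) (Os : Fin (N + 1) → ValuationSubring K) (e : Fin N → K)
      (he : ∀ i : Fin N, e i ∈ Os i.castSucc), (∀ i : Fin N, e i ≠ 0) ∧
      (∀ i : Fin N, IsLocalRing.maximalIdeal (Os i.castSucc) =
        Ideal.span {(⟨e i, he i⟩ : Os i.castSucc)}) ∧
      (∀ (i : Fin N) (x : K), x ∈ Os i.succ ↔ ∃ n : ℕ, e i ^ n * x ∈ Os i.castSucc) ∧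
      Os (Fin.last N) = ⊤ ∧ Os 0 = O'
  · obtain ⟨N, Os, e, he, he0, hmax, hloc, htop, h0⟩ := hD
    subst h0
    haveI : Fact p.Prime := ⟨hp⟩
    exact smoothFactor_of_discreteJumps p k K N Os e he he0 hmax hloc htop hO' R hR hRO'
  have hnN : ¬ IsNoetherianRing O' := fun hN => hD (stub_discreteChainOfNoetherian O' hN)
  -- families 2, 4, 5, 6, 6', 8: relative local uniformization at `O'`
  by_cases hLU : RelLocalUniformization k K O'
  · exact smoothFactor_of_relLocalUniformization k K hK O' hO' hLU R hR hRO'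
  have hnA : ¬ IsAbhyankarPlace O' (algebraMap k K).fieldRange ⊤ :=
    fun hA => hLU (relLU_of_isAbhyankarPlace_of_perfectField hK O' hO' hA)
  have hnR2 : ¬ ∃ B : Subalgebra k K, B.FG ∧ B.toSubring ≤ O'.toSubring ∧
      (∀ z : K, ∃ a ∈ B, ∃ b ∈ B, b ≠ 0 ∧ z = a / b) ∧
      IsRegularLocalRing (locAtCentre B.toSubring O') ∧
      ringKrullDim (locAtCentre B.toSubring O') ≤ 2 :=
    fun h => hLU (relLU_of_exists_regularCentre O' h)
  -- the core
  exact hC p hp k K hK O' hO' hZ hnN hnA hD hnR2 hLU R hR hRO'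

/-- **The core is a special case of the crux** (more hypotheses). [folklore] -/
theorem core_of_valuativeSmoothing (hV : ValuativeSmoothing) :
    ∀ p : ℕ, p.Prime →
      ∀ (k K : Type) [Field k] [CharP k p] [PerfectField k] [Field K] [Algebra k K],
        (⊤ : IntermediateField k K).FG → ∀ O : ValuationSubring K,
          (∀ c : k, algebraMap k K c ∈ O) →
          (∀ x ∈ O, ∃ f : k[X], f ≠ 0 ∧ Polynomial.aeval x f ∈ O.nonunits) →
          ¬ IsNoetherianRing O →
          ¬ IsAbhyankarPlace O (algebraMap k K).fieldRange ⊤ →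
          (¬ ∃ (N : ℕ) (Os : Fin (N + 1) → ValuationSubring K) (e : Fin N → K)
            (he : ∀ i : Fin N, e i ∈ Os i.castSucc), (∀ i : Fin N, e i ≠ 0) ∧
            (∀ i : Fin N, IsLocalRing.maximalIdeal (Os i.castSucc) =
              Ideal.span {(⟨e i, he i⟩ : Os i.castSucc)}) ∧
            (∀ (i : Fin N) (x : K), x ∈ Os i.succ ↔ ∃ n : ℕ, e i ^ n * x ∈ Os i.castSucc) ∧
            Os (Fin.last N) = ⊤ ∧ Os 0 = O) →
          (¬ ∃ B : Subalgebra k K, B.FG ∧ B.toSubring ≤ O.toSubring ∧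
            (∀ z : K, ∃ a ∈ B, ∃ b ∈ B, b ≠ 0 ∧ z = a / b) ∧
            IsRegularLocalRing (locAtCentre B.toSubring O) ∧
            ringKrullDim (locAtCentre B.toSubring O) ≤ 2) →
          ¬ RelLocalUniformization k K O →
          ∀ R : Subalgebra k K, R.FG → R.toSubring ≤ O.toSubring →
            ∃ (T : Type) (_ : CommRing T) (_ : Algebra k T), Algebra.Smooth k T ∧
              ∃ (ψ : R →ₐ[k] T) (χ : T →ₐ[k] K), (∀ t : T, χ t ∈ O) ∧ ∀ r : R, χ (ψ r) = (r : K) :=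
  fun p hp k K _ _ _ _ _ hK O hO _ _ _ _ _ _ R hR hRO => hV p hp k K hK O hO R hR hRO

/-- **`ValuativeSmoothing` ⟺ the crux on its open core** (six side conditions; unconditional).
The right-hand side is the registered open stub `stub_coreCrux` of line `birth` (r8).
[folklore] -/
theorem valuativeSmoothing_iff_core :
    Summit.ResolutionOfSingularities.ResolutionOfSingularities.Theses.IndSmooth.ValuativeSmoothing ↔
    (∀ p : ℕ, p.Prime →
      ∀ (k K : Type) [Field k] [CharP k p] [PerfectField k] [Field K] [Algebra k K],
        (⊤ : IntermediateField k K).FG → ∀ O : ValuationSubring K,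
          (∀ c : k, algebraMap k K c ∈ O) →
          (∀ x ∈ O, ∃ f : k[X], f ≠ 0 ∧ Polynomial.aeval x f ∈ O.nonunits) →
          ¬ IsNoetherianRing O →
          ¬ IsAbhyankarPlace O (algebraMap k K).fieldRange ⊤ →
          (¬ ∃ (N : ℕ) (Os : Fin (N + 1) → ValuationSubring K) (e : Fin N → K)
            (he : ∀ i : Fin N, e i ∈ Os i.castSucc), (∀ i : Fin N, e i ≠ 0) ∧
            (∀ i : Fin N, IsLocalRing.maximalIdeal (Os i.castSucc) =
              Ideal.span {(⟨e i, he i⟩ : Os i.castSucc)}) ∧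
            (∀ (i : Fin N) (x : K), x ∈ Os i.succ ↔ ∃ n : ℕ, e i ^ n * x ∈ Os i.castSucc) ∧
            Os (Fin.last N) = ⊤ ∧ Os 0 = O) →
          (¬ ∃ B : Subalgebra k K, B.FG ∧ B.toSubring ≤ O.toSubring ∧
            (∀ z : K, ∃ a ∈ B, ∃ b ∈ B, b ≠ 0 ∧ z = a / b) ∧
            IsRegularLocalRing (locAtCentre B.toSubring O) ∧
            ringKrullDim (locAtCentre B.toSubring O) ≤ 2) →
          ¬ RelLocalUniformization k K O →
          ∀ R : Subalgebra k K, R.FG → R.toSubring ≤ O.toSubring →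
            ∃ (T : Type) (_ : CommRing T) (_ : Algebra k T), Algebra.Smooth k T ∧
              ∃ (ψ : R →ₐ[k] T) (χ : T →ₐ[k] K), (∀ t : T, χ t ∈ O) ∧ ∀ r : R, χ (ψ r) = (r : K)) :=
  ⟨core_of_valuativeSmoothing, valuativeSmoothing_of_core⟩

/-- **`ValuativeSmoothing` ⟺ the crux on the MINIMAL core**: zero-dimensional valuation rings
with no discrete chain of coarsenings and no relative local uniformization (the other three
side conditions being consequences). [folklore] -/
theorem valuativeSmoothing_iff_minimalCore :
    ValuativeSmoothing ↔
    (∀ p : ℕ, p.Prime →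
      ∀ (k K : Type) [Field k] [CharP k p] [PerfectField k] [Field K] [Algebra k K],
        (⊤ : IntermediateField k K).FG → ∀ O : ValuationSubring K,
          (∀ c : k, algebraMap k K c ∈ O) →
          (∀ x ∈ O, ∃ f : k[X], f ≠ 0 ∧ Polynomial.aeval x f ∈ O.nonunits) →
          (¬ ∃ (N : ℕ) (Os : Fin (N + 1) → ValuationSubring K) (e : Fin N → K)
            (he : ∀ i : Fin N, e i ∈ Os i.castSucc), (∀ i : Fin N, e i ≠ 0) ∧
            (∀ i : Fin N, IsLocalRing.maximalIdeal (Os i.castSucc) =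
              Ideal.span {(⟨e i, he i⟩ : Os i.castSucc)}) ∧
            (∀ (i : Fin N) (x : K), x ∈ Os i.succ ↔ ∃ n : ℕ, e i ^ n * x ∈ Os i.castSucc) ∧
            Os (Fin.last N) = ⊤ ∧ Os 0 = O) →
          ¬ RelLocalUniformization k K O →
          ∀ R : Subalgebra k K, R.FG → R.toSubring ≤ O.toSubring →
            ∃ (T : Type) (_ : CommRing T) (_ : Algebra k T), Algebra.Smooth k T ∧
              ∃ (ψ : R →ₐ[k] T) (χ : T →ₐ[k] K), (∀ t : T, χ t ∈ O) ∧ ∀ r : R, χ (ψ r) = (r : K)) := by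
  refine ⟨fun hV p hp k K _ _ _ _ _ hK O hO _ _ _ R hR hRO => hV p hp k K hK O hO R hR hRO,
    fun h3 => valuativeSmoothing_of_core ?_⟩
  intro p hp k K _ _ _ _ _ hK O hO hZ _ _ hnD _ hnLU R hR hRO
  exact h3 p hp k K hK O hO hZ hnD hnLU R hR hRO

end Summit.ResolutionOfSingularities.ResolutionOfSingularities.Theorems.ValuativeSmoothing
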